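import Summits.CriticalPhenomena.PercolationContinuityZ3.Theorems.PercNearOneGluingNoHeavyConstsCrossReachSharpGadget
import HarnessLib

/-!
# The measure-level strata cone is EXACTLY `{α ≥ β ≥ γ ≥ 0}`: necessity (PAPER-2 track (ii); lane `prim-facecert`, gen 17)

builds on p205010 (kernel theorem, internal audit signed; external expert review pending).  Support file (`--supports
stmt-CriticalPhenomena-4575`); uses the series–parallel gadget of `…ConstsCrossReachSharpGadget.lean`.  Theorems only; no sorries; standard
axioms.

THE STRATA (prim-nh-lead-4575 LEAD-GEN106 §2 / LEAD-GEN110 §3).  Two independent copies `ω₀, ω₁ ~ μ = prodBernoulli w`, sources `S`,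
targets `T`, `U = {S ↔ T}`, `D = Uᶜ`, increasing edge-cluster events `A = {P(C_S)}`, `B = {Q(C_S)}`, `∇a = 1_A(ω₀) − 1_A(ω₁)`; `K_j` = the part of
`E⊗E[∇a ∇b]` on {exactly `j` copies reach `T`}:
  `K₀/2 = μ(ABD)μ(D) − μ(AD)μ(BD)`,  `K₁/2 = μ(ABU)μ(D) + μ(ABD)μ(U) − μ(AU)μ(BD) − μ(BU)μ(AD)` (cross-reach X/2),
  `K₂/2 = μ(ABU)μ(U) − μ(AU)μ(BU)`.
Which combinations `αK₀ + βK₁ + γK₂` are nonnegative laws of percolation?  SUFFICIENT (tree theorems): `(1,0,0)` = BHK's Theorem 1.3 with sets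
(`setClusterEventExchange`), `(1,1,0)` = hard-core Harris (one target vertex: `Consts.hardCoreHarris_measure_one`, p328546), `(1,1,1)` = Harris;
their cone is `{α ≥ β ≥ γ ≥ 0}` (`αK₀+βK₁+γK₂ = (α−β)K₀ + (β−γ)(K₀+K₁) + γ(K₀+K₁+K₂)`).  The lead recorded the cone "generated by (1,½,0) and
(1,1,1), open rays (1,0,0), (1,1,0)" (LEAD-GEN110 §3).
* `Consts.strataCone_sufficient_one` — SUFFICIENCY for one target vertex (appended): `α ≥ β ≥ γ ≥ 0` ⟹ the combination is `≥ 0`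
  (the displayed decomposition + the three tree theorems), for every finite vertex type, source set and pair of increasing events.
* `Consts.strataCone_necessary` — **NECESSITY (this file): if `α(K₀/2) + β(K₁/2) + γ(K₂/2) ≥ 0` on every finite weighted graph for all
  `S, T, P, Q`, then `β ≤ α`, `γ ≤ β` and `0 ≤ γ`.**  So for one target vertex the valid cone is EXACTLY `{α ≥ β ≥ γ ≥ 0}` — nothing beyond
  BHK, hard-core Harris and Harris.  Proof: on the gadget `01 (½), 12 (1), 02 (½), 23 (t)` with `A = [01 ∈ C_S]`, `B = [02 ∈ C_S]`, `S = {0}`,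
  `T = {3}` one has `(K₀, K₁, K₂)/2 = (t(1−t), −t(1−2t), −t²)/16` (`CrossReachSharp.cells`), i.e. `(α − β) + t(2β − α − γ) ≥ 0` for all
  `t ∈ (0, 1]`: `t = 1` gives `β ≥ γ`, `t ↓ 0` gives `α ≥ β`; and on the two-vertex-plus-leaf instance `01 (½), 02 (1)` with `A = B = [01 ∈ C_S]`,
  `T = {2}` (so `μ(U) = 1`) only `K₂/2 = ¼` survives, giving `γ ≥ 0`.
[cite: VandenbergHaggstromKahn2005, Thm. 1.3 (p. 6) with Remark 1 after Thm. 1.2 (p. 5)] [cite: Harris1960, Lemma 4.1]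
-/

noncomputable section

namespace Summit.CriticalPhenomena.PercolationContinuityZ3.Theorems

namespace Consts

open MeasureTheory Set Literature.Probability.LatticeModels Literature.Probability.Percolation
open scoped Classical

/-- **Necessity half of the exact measure-level strata cone.**  If the combination `α·K₀ + β·K₁ + γ·K₂` (halved strata written with the
eight cell masses, as in the module docstring) is nonnegative for every finite weighted graph on `Fin n`, all source/target sets and all
increasing edge-cluster events, then `β ≤ α`, `γ ≤ β` and `0 ≤ γ`.  (this lane, gen 17)
[cite: VandenbergHaggstromKahn2005, Thm. 1.3 (p. 6) with Remark 1 after Thm. 1.2 (p. 5)] -/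
theorem strataCone_necessary (α β γ : ℝ)
    (h : ∀ (n : ℕ) (w : Sym2 (Fin n) → unitInterval) (S T : Set (Fin n)) (P Q : Set (Sym2 (Fin n)) → Prop),
      (∀ ⦃C C' : Set (Sym2 (Fin n))⦄, C ⊆ C' → P C → P C') → (∀ ⦃C C' : Set (Sym2 (Fin n))⦄, C ⊆ C' → Q C → Q C') →
      0 ≤ α * ((prodBernoulli w).real ({ω : BondConfig (Fin n) | P (⋃ s ∈ S, openEdgeCluster ω s)} ∩
                {ω | Q (⋃ s ∈ S, openEdgeCluster ω s)} ∩ {ω | ∀ s ∈ S, ∀ t ∈ T, ¬ (openGraph ω).Reachable s t}) *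
              (prodBernoulli w).real {ω : BondConfig (Fin n) | ∀ s ∈ S, ∀ t ∈ T, ¬ (openGraph ω).Reachable s t} -
            (prodBernoulli w).real ({ω : BondConfig (Fin n) | P (⋃ s ∈ S, openEdgeCluster ω s)} ∩
                {ω | ∀ s ∈ S, ∀ t ∈ T, ¬ (openGraph ω).Reachable s t}) *
              (prodBernoulli w).real ({ω : BondConfig (Fin n) | Q (⋃ s ∈ S, openEdgeCluster ω s)} ∩
                {ω | ∀ s ∈ S, ∀ t ∈ T, ¬ (openGraph ω).Reachable s t})) +
        β * ((prodBernoulli w).real ({ω : BondConfig (Fin n) | P (⋃ s ∈ S, openEdgeCluster ω s)} ∩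
                {ω | Q (⋃ s ∈ S, openEdgeCluster ω s)} ∩ {ω | ∃ s ∈ S, ∃ t ∈ T, (openGraph ω).Reachable s t}) *
              (prodBernoulli w).real {ω : BondConfig (Fin n) | ∀ s ∈ S, ∀ t ∈ T, ¬ (openGraph ω).Reachable s t} +
            (prodBernoulli w).real ({ω : BondConfig (Fin n) | P (⋃ s ∈ S, openEdgeCluster ω s)} ∩
                {ω | Q (⋃ s ∈ S, openEdgeCluster ω s)} ∩ {ω | ∀ s ∈ S, ∀ t ∈ T, ¬ (openGraph ω).Reachable s t}) *
              (prodBernoulli w).real {ω : BondConfig (Fin n) | ∃ s ∈ S, ∃ t ∈ T, (openGraph ω).Reachable s t} -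
            (prodBernoulli w).real ({ω : BondConfig (Fin n) | P (⋃ s ∈ S, openEdgeCluster ω s)} ∩
                {ω | ∃ s ∈ S, ∃ t ∈ T, (openGraph ω).Reachable s t}) *
              (prodBernoulli w).real ({ω : BondConfig (Fin n) | Q (⋃ s ∈ S, openEdgeCluster ω s)} ∩
                {ω | ∀ s ∈ S, ∀ t ∈ T, ¬ (openGraph ω).Reachable s t}) -
            (prodBernoulli w).real ({ω : BondConfig (Fin n) | Q (⋃ s ∈ S, openEdgeCluster ω s)} ∩
                {ω | ∃ s ∈ S, ∃ t ∈ T, (openGraph ω).Reachable s t}) *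
              (prodBernoulli w).real ({ω : BondConfig (Fin n) | P (⋃ s ∈ S, openEdgeCluster ω s)} ∩
                {ω | ∀ s ∈ S, ∀ t ∈ T, ¬ (openGraph ω).Reachable s t})) +
        γ * ((prodBernoulli w).real ({ω : BondConfig (Fin n) | P (⋃ s ∈ S, openEdgeCluster ω s)} ∩
                {ω | Q (⋃ s ∈ S, openEdgeCluster ω s)} ∩ {ω | ∃ s ∈ S, ∃ t ∈ T, (openGraph ω).Reachable s t}) *
              (prodBernoulli w).real {ω : BondConfig (Fin n) | ∃ s ∈ S, ∃ t ∈ T, (openGraph ω).Reachable s t} -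
            (prodBernoulli w).real ({ω : BondConfig (Fin n) | P (⋃ s ∈ S, openEdgeCluster ω s)} ∩
                {ω | ∃ s ∈ S, ∃ t ∈ T, (openGraph ω).Reachable s t}) *
              (prodBernoulli w).real ({ω : BondConfig (Fin n) | Q (⋃ s ∈ S, openEdgeCluster ω s)} ∩
                {ω | ∃ s ∈ S, ∃ t ∈ T, (openGraph ω).Reachable s t}))) :
    β ≤ α ∧ γ ≤ β ∧ 0 ≤ γ := by
  have hmeas : ∀ E : Set (BondConfig (Fin 4)), MeasurableSet E := fun _ => MeasurableSet.of_discrete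
  have h01 : (0 : Fin 4) ≠ 1 := by decide
  have h02 : (0 : Fin 4) ≠ 2 := by decide
  have h03 : (0 : Fin 4) ≠ 3 := by decide
  have h12 : (1 : Fin 4) ≠ 2 := by decide
  have h13 : (1 : Fin 4) ≠ 3 := by decide
  have h23 : (2 : Fin 4) ≠ 3 := by decide
  set hf : unitInterval := ⟨1 / 2, by norm_num, by norm_num⟩ with hhf
  -- FAMILY 1: the gadget `01 (½), 12 (1), 02 (½), 23 (t)`, `A = [01 ∈ C]`, `B = [02 ∈ C]`, `S = {0}`, `T = {3}`:
  -- the hypothesis reads `((α − β) + t(2β − α − γ))·t/16 ≥ 0`.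
  have fam1 : ∀ t : ℝ, 0 ≤ t → t ≤ 1 → 0 ≤ ((α - β) + t * (2 * β - α - γ)) * t := by
    intro t ht0 ht1
    set tt : unitInterval := ⟨t, ht0, ht1⟩ with htt
    set W : Sym2 (Fin 4) → unitInterval := fun e =>
      if e = s(0, 1) then hf else if e = s(1, 2) then 1 else if e = s(0, 2) then hf else if e = s(2, 3) then tt else 0 with hW
    have w01 : (W s(0, 1) : ℝ) = 1 / 2 := by simp [hW, hhf]
    have w12 : (W s(1, 2) : ℝ) = 1 := by simp [hW, Set.Icc.coe_one]
    have w02 : (W s(0, 2) : ℝ) = 1 / 2 := by simp [hW, hhf]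
    have w23 : (W s(2, 3) : ℝ) = t := by simp [hW, htt]
    have hw0 : ∀ e, e ∉ ({s((0 : Fin 4), 1), s(1, 2), s(0, 2), s(2, 3)} : Finset (Sym2 (Fin 4))) → W e = 0 := by
      intro e he
      simp only [Finset.mem_insert, Finset.mem_singleton, not_or] at he
      simp [hW, he.1, he.2.1, he.2.2.1, he.2.2.2]
    have hh := h 4 W {0} {3} (fun C => s(0, 1) ∈ C) (fun C => s(0, 2) ∈ C) (fun C C' hCC' h => hCC' h)
      (fun C C' hCC' h => hCC' h)
    simp only at hh
    rw [CrossReachSharp.edgeEvent_eq h01, CrossReachSharp.edgeEvent_eq h02, CrossReachSharp.reachEvent_eq,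
      CrossReachSharp.notReachEvent_eq] at hh
    obtain ⟨cU, cD, cAU, cAD, cBU, cBD, cABU, cABD⟩ := CrossReachSharp.cells W h01 h02 h03 h12 h13 h23 hw0
    rw [cU, cD, cAU, cAD, cBU, cBD, cABU, cABD, w01, w12, w02, w23] at hh
    nlinarith [hh]
  -- FAMILY 2: `01 (½), 02 (1)`, `A = B = [01 ∈ C]`, `S = {0}`, `T = {2}`: `μ(U) = 1`, only `K₂/2 = ¼` survives.
  have fam2 : 0 ≤ γ := by
    set W : Sym2 (Fin 4) → unitInterval := fun e => if e = s(0, 1) then hf else if e = s(0, 2) then 1 else 0 with hW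
    have w01 : (W s(0, 1) : ℝ) = 1 / 2 := by simp [hW, hhf]
    have w02 : W s(0, 2) = 1 := by simp [hW]
    have hh := h 4 W {0} {2} (fun C => s(0, 1) ∈ C) (fun C => s(0, 1) ∈ C) (fun C C' hCC' h => hCC' h)
      (fun C C' hCC' h => hCC' h)
    simp only at hh
    rw [CrossReachSharp.edgeEvent_eq h01, CrossReachSharp.reachEvent_eq, CrossReachSharp.notReachEvent_eq, inter_self] at hh
    -- `μ(U) = 1` since the pair `02` is open with probability `1`
    have hU1 : (prodBernoulli W).real {ω : BondConfig (Fin 4) | (openGraph ω).Reachable 0 2} = 1 := by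
      apply le_antisymm ((measureReal_mono (Set.subset_univ _)).trans (le_of_eq probReal_univ))
      have hsub : {ω : BondConfig (Fin 4) | s((0 : Fin 4), 2) ∈ ω} ⊆ {ω | (openGraph ω).Reachable 0 2} :=
        fun ω hω => ((openGraph_adj ω 0 2).2 ⟨hω, h02⟩).reachable
      have := measureReal_mono (μ := prodBernoulli W) hsub
      rw [prodBernoulli_real_setOf_mem, w02, Set.Icc.coe_one] at this
      exact this
    have hD0 : (prodBernoulli W).real {ω : BondConfig (Fin 4) | (openGraph ω).Reachable 0 2}ᶜ = 0 := by
      rw [measureReal_compl (hmeas _), probReal_univ, hU1, sub_self]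
    have hAD : (prodBernoulli W).real ({ω : BondConfig (Fin 4) | s((0 : Fin 4), 1) ∈ ω} ∩
        {ω | (openGraph ω).Reachable 0 2}ᶜ) = 0 :=
      le_antisymm (le_trans (measureReal_mono inter_subset_right) hD0.le) measureReal_nonneg
    have hAU : (prodBernoulli W).real ({ω : BondConfig (Fin 4) | s((0 : Fin 4), 1) ∈ ω} ∩
        {ω | (openGraph ω).Reachable 0 2}) = 1 / 2 := by
      have hs := measureReal_inter_add_sdiff (μ := prodBernoulli W) (s := {ω : BondConfig (Fin 4) | s((0 : Fin 4), 1) ∈ ω})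
        (hmeas {ω | (openGraph ω).Reachable 0 2})
      have hdiff : {ω : BondConfig (Fin 4) | s((0 : Fin 4), 1) ∈ ω} \ {ω | (openGraph ω).Reachable 0 2} =
          {ω : BondConfig (Fin 4) | s((0 : Fin 4), 1) ∈ ω} ∩ {ω | (openGraph ω).Reachable 0 2}ᶜ := rfl
      rw [hdiff, hAD, prodBernoulli_real_setOf_mem, w01] at hs
      linarith
    rw [hU1, hD0, hAD, hAU] at hh
    nlinarith [hh]
  -- conclusions
  have hβγ : γ ≤ β := by
    have := fam1 1 zero_le_one le_rfl
    nlinarith [this]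
  have hαβ : β ≤ α := by
    by_contra hlt
    push Not at hlt
    -- take `t = min 1 ((β − α) / (2 (|2β − α − γ| + 1)))`
    set c : ℝ := 2 * β - α - γ with hc
    set t : ℝ := min 1 ((β - α) / (2 * (|c| + 1))) with ht
    have hpos : 0 < (β - α) / (2 * (|c| + 1)) := by
      apply div_pos (by linarith); positivity
    have ht0 : 0 < t := lt_min zero_lt_one hpos
    have ht1 : t ≤ 1 := min_le_left _ _
    have ht2 : t ≤ (β - α) / (2 * (|c| + 1)) := min_le_right _ _
    have key := fam1 t ht0.le ht1
    -- `(α − β) + t c < 0`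
    have htc : t * c ≤ t * |c| := mul_le_mul_of_nonneg_left (le_abs_self c) ht0.le
    have hbound : t * |c| ≤ (β - α) / 2 := by
      have h1 : t * |c| ≤ (β - α) / (2 * (|c| + 1)) * |c| := mul_le_mul_of_nonneg_right ht2 (abs_nonneg c)
      have h2 : (β - α) / (2 * (|c| + 1)) * |c| ≤ (β - α) / 2 := by
        rw [div_mul_eq_mul_div, div_le_div_iff₀ (by positivity) (by norm_num)]
        nlinarith [abs_nonneg c]
      linarith
    have hneg : (α - β) + t * c < 0 := by linarith
    have : ((α - β) + t * c) * t < 0 := mul_neg_of_neg_of_pos hneg ht0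
    linarith
  exact ⟨hαβ, hβγ, fam2⟩

/-- **Sufficiency half of the exact measure-level strata cone, one target vertex.**  For bond percolation on any finite vertex type,
a source set `S`, `T = {v}`, increasing edge-cluster events `A = {P(C_S)}`, `B = {Q(C_S)}`, and reals `α ≥ β ≥ γ ≥ 0`:
`α·K₀/2 + β·K₁/2 + γ·K₂/2 ≥ 0`, because `αK₀ + βK₁ + γK₂ = (α−β)K₀ + (β−γ)(K₀+K₁) + γ(K₀+K₁+K₂)` and the three brackets are
BHK's Theorem 1.3 with sets (`setClusterEventExchange`), hard-core Harris at one vertex (`Consts.hardCoreHarris_measure_one`) and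
Harris.  With `Consts.strataCone_necessary`: for one target vertex the valid cone is EXACTLY `{α ≥ β ≥ γ ≥ 0}`.  (this lane, gen 17)
[cite: VandenbergHaggstromKahn2005, Thm. 1.3 (p. 6) with Remark 1 after Thm. 1.2 (p. 5)] [cite: Harris1960, Lemma 4.1] -/
theorem strataCone_sufficient_one {V : Type*} [Fintype V] (w : Sym2 V → unitInterval) (S : Set V) (v : V)
    (P Q : Set (Sym2 V) → Prop) (hP : ∀ ⦃C C' : Set (Sym2 V)⦄, C ⊆ C' → P C → P C')
    (hQ : ∀ ⦃C C' : Set (Sym2 V)⦄, C ⊆ C' → Q C → Q C') {α β γ : ℝ} (hβα : β ≤ α) (hγβ : γ ≤ β) (hγ : 0 ≤ γ) :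
    0 ≤ α * ((prodBernoulli w).real ({ω : BondConfig V | P (⋃ s ∈ S, openEdgeCluster ω s)} ∩
              {ω | Q (⋃ s ∈ S, openEdgeCluster ω s)} ∩ {ω | ∀ s ∈ S, ∀ t ∈ ({v} : Set V), ¬ (openGraph ω).Reachable s t}) *
            (prodBernoulli w).real {ω : BondConfig V | ∀ s ∈ S, ∀ t ∈ ({v} : Set V), ¬ (openGraph ω).Reachable s t} -
          (prodBernoulli w).real ({ω : BondConfig V | P (⋃ s ∈ S, openEdgeCluster ω s)} ∩
              {ω | ∀ s ∈ S, ∀ t ∈ ({v} : Set V), ¬ (openGraph ω).Reachable s t}) *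
            (prodBernoulli w).real ({ω : BondConfig V | Q (⋃ s ∈ S, openEdgeCluster ω s)} ∩
              {ω | ∀ s ∈ S, ∀ t ∈ ({v} : Set V), ¬ (openGraph ω).Reachable s t})) +
      β * ((prodBernoulli w).real ({ω : BondConfig V | P (⋃ s ∈ S, openEdgeCluster ω s)} ∩
              {ω | Q (⋃ s ∈ S, openEdgeCluster ω s)} ∩ {ω | ∃ s ∈ S, ∃ t ∈ ({v} : Set V), (openGraph ω).Reachable s t}) *
            (prodBernoulli w).real {ω : BondConfig V | ∀ s ∈ S, ∀ t ∈ ({v} : Set V), ¬ (openGraph ω).Reachable s t} +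
          (prodBernoulli w).real ({ω : BondConfig V | P (⋃ s ∈ S, openEdgeCluster ω s)} ∩
              {ω | Q (⋃ s ∈ S, openEdgeCluster ω s)} ∩ {ω | ∀ s ∈ S, ∀ t ∈ ({v} : Set V), ¬ (openGraph ω).Reachable s t}) *
            (prodBernoulli w).real {ω : BondConfig V | ∃ s ∈ S, ∃ t ∈ ({v} : Set V), (openGraph ω).Reachable s t} -
          (prodBernoulli w).real ({ω : BondConfig V | P (⋃ s ∈ S, openEdgeCluster ω s)} ∩
              {ω | ∃ s ∈ S, ∃ t ∈ ({v} : Set V), (openGraph ω).Reachable s t}) *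
            (prodBernoulli w).real ({ω : BondConfig V | Q (⋃ s ∈ S, openEdgeCluster ω s)} ∩
              {ω | ∀ s ∈ S, ∀ t ∈ ({v} : Set V), ¬ (openGraph ω).Reachable s t}) -
          (prodBernoulli w).real ({ω : BondConfig V | Q (⋃ s ∈ S, openEdgeCluster ω s)} ∩
              {ω | ∃ s ∈ S, ∃ t ∈ ({v} : Set V), (openGraph ω).Reachable s t}) *
            (prodBernoulli w).real ({ω : BondConfig V | P (⋃ s ∈ S, openEdgeCluster ω s)} ∩
              {ω | ∀ s ∈ S, ∀ t ∈ ({v} : Set V), ¬ (openGraph ω).Reachable s t})) +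
      γ * ((prodBernoulli w).real ({ω : BondConfig V | P (⋃ s ∈ S, openEdgeCluster ω s)} ∩
              {ω | Q (⋃ s ∈ S, openEdgeCluster ω s)} ∩ {ω | ∃ s ∈ S, ∃ t ∈ ({v} : Set V), (openGraph ω).Reachable s t}) *
            (prodBernoulli w).real {ω : BondConfig V | ∃ s ∈ S, ∃ t ∈ ({v} : Set V), (openGraph ω).Reachable s t} -
          (prodBernoulli w).real ({ω : BondConfig V | P (⋃ s ∈ S, openEdgeCluster ω s)} ∩
              {ω | ∃ s ∈ S, ∃ t ∈ ({v} : Set V), (openGraph ω).Reachable s t}) *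
            (prodBernoulli w).real ({ω : BondConfig V | Q (⋃ s ∈ S, openEdgeCluster ω s)} ∩
              {ω | ∃ s ∈ S, ∃ t ∈ ({v} : Set V), (openGraph ω).Reachable s t})) := by
  have hmeas : ∀ E : Set (BondConfig V), MeasurableSet E := fun _ => MeasurableSet.of_discrete
  -- BHK's Theorem 1.3 with sets on `D = {S ↮ {v}}` (before renaming the events)
  have h1 := setClusterEventExchange w S ({v} : Set V) P Q (fun _ => True) (fun _ => True) hP hQ
    (fun _ _ _ _ => trivial) (fun _ _ _ _ => trivial)
  simp only [setOf_true, inter_univ] at h1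
  have hHC := hardCoreHarris_measure_one w S v P Q hP hQ
  -- monotonicity for Harris
  have hmonoC : ∀ ⦃ω ω' : BondConfig V⦄, ω ⊆ ω' →
      (⋃ s ∈ S, openEdgeCluster ω s) ⊆ (⋃ s ∈ S, openEdgeCluster ω' s) :=
    fun ω ω' hle => Set.iUnion₂_mono fun s _ => BHK2006.openEdgeCluster_mono hle s
  have hAup : IsUpperSet {ω : BondConfig V | P (⋃ s ∈ S, openEdgeCluster ω s)} :=
    fun ω ω' hle hω => hP (hmonoC hle) hω
  have hBup : IsUpperSet {ω : BondConfig V | Q (⋃ s ∈ S, openEdgeCluster ω s)} :=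
    fun ω ω' hle hω => hQ (hmonoC hle) hω
  have hH := prodBernoulli_harris_via_fibres w hAup hBup
  -- `T = {v}`: the reach / non-reach events in one-vertex form
  have hU : {ω : BondConfig V | ∃ s ∈ S, ∃ t ∈ ({v} : Set V), (openGraph ω).Reachable s t} =
      {ω : BondConfig V | ∃ s ∈ S, (openGraph ω).Reachable s v} := by
    ext ω; simp
  have hD : {ω : BondConfig V | ∀ s ∈ S, ∀ t ∈ ({v} : Set V), ¬ (openGraph ω).Reachable s t} =
      {ω : BondConfig V | ∃ s ∈ S, (openGraph ω).Reachable s v}ᶜ := by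
    ext ω; simp
  rw [hU, hD]
  rw [hD] at h1
  set Aset : Set (BondConfig V) := {ω : BondConfig V | P (⋃ s ∈ S, openEdgeCluster ω s)} with hAset
  set Bset : Set (BondConfig V) := {ω : BondConfig V | Q (⋃ s ∈ S, openEdgeCluster ω s)} with hBset
  set Uv : Set (BondConfig V) := {ω : BondConfig V | ∃ s ∈ S, (openGraph ω).Reachable s v} with hUv
  rw [inter_comm Uvᶜ Aset, inter_comm Uvᶜ Bset, inter_comm Uvᶜ (Aset ∩ Bset)] at h1
  -- the `D`-cells by subtraction
  have hc : ∀ F : Set (BondConfig V), (prodBernoulli w).real (F ∩ Uvᶜ) =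
      (prodBernoulli w).real F - (prodBernoulli w).real (F ∩ Uv) := by
    intro F
    have h := measureReal_inter_add_sdiff (μ := prodBernoulli w) (s := F) (hmeas Uv)
    have hdiff : F \ Uv = F ∩ Uvᶜ := rfl
    rw [hdiff] at h
    linarith
  have hUD : (prodBernoulli w).real Uvᶜ = 1 - (prodBernoulli w).real Uv := by
    rw [measureReal_compl (hmeas _), probReal_univ]
  rw [hc, hc, hc, hUD]
  rw [hc, hc, hc, hUD] at h1
  set a : ℝ := (prodBernoulli w).real Aset
  set b : ℝ := (prodBernoulli w).real Bset
  set x : ℝ := (prodBernoulli w).real (Aset ∩ Bset)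
  set r : ℝ := (prodBernoulli w).real Uv
  set aU : ℝ := (prodBernoulli w).real (Aset ∩ Uv)
  set bU : ℝ := (prodBernoulli w).real (Bset ∩ Uv)
  set xU : ℝ := (prodBernoulli w).real (Aset ∩ Bset ∩ Uv)
  have s1 : 0 ≤ (x - xU) * (1 - r) - (a - aU) * (b - bU) := by linarith
  have s2 : 0 ≤ (x - xU * r) - (a * b - aU * bU) := by linarith
  have s3 : 0 ≤ x - a * b := by linarith
  have expand : α * ((x - xU) * (1 - r) - (a - aU) * (b - bU)) +
      β * (xU * (1 - r) + (x - xU) * r - aU * (b - bU) - bU * (a - aU)) + γ * (xU * r - aU * bU) =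
      (α - β) * ((x - xU) * (1 - r) - (a - aU) * (b - bU)) + (β - γ) * ((x - xU * r) - (a * b - aU * bU)) +
        γ * (x - a * b) := by ring
  rw [expand]
  have t1 : 0 ≤ (α - β) * ((x - xU) * (1 - r) - (a - aU) * (b - bU)) := mul_nonneg (sub_nonneg.2 hβα) s1
  have t2 : 0 ≤ (β - γ) * ((x - xU * r) - (a * b - aU * bU)) := mul_nonneg (sub_nonneg.2 hγβ) s2
  have t3 : 0 ≤ γ * (x - a * b) := mul_nonneg hγ s3
  linarith

end Consts

end Summit.CriticalPhenomena.PercolationContinuityZ3.Theorems
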